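import Literature.Analysis.FluidPDE.AncientSimilarityVorticity
import Literature.Analysis.FluidPDE.PressurePoisson
import Literature.Barriers.NavierStokesRegularity.NavierStokesInequalitySwirlCalculus
import HarnessLib

/-!
# Route CorkscrewDynamo · crux `CorkscrewProfile` (stmt-NavierStokesRegularity-11282) — tool stub V2: the vertical-vorticity flux in divergence form

Tool stub `stub_verticalVorticityDivergenceForm` of line `registered` (skeleton v13, lead c6): the
PURE CALCULUS half of the vertical-vorticity flux identity for a rotated Leray profile
`U : ℝ³ → ℝ³` (`U ∈ C³`, `div U = 0`). With `ω = curl U`, the vertical vorticity `ω₃ = (curl U ·) 2`,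
`U₃ = (U ·) 2`, the co-rotating drift `b y = U y + ½ y − α J y` (`J = rotGen = e₃ × ·`) and the
flux `F = ω₃ b − ∇ω₃ − U₃ ω`,

  `div F = Dω[b]₃ + (3/2) ω₃ − (Δω)₃ − DU[ω]₃`.

Ingredients: the Leibniz rule `div (θ u) = θ div u + ⟪u, ∇θ⟫` (`divergence_smul_apply`) for the
two scalar multiples; `div b = div U + 3/2 − α div J = 3/2` (`div U = 0`; `div (½ id) = 3/2` on `ℝ³`,
`divergence_half_smul_id`; `div J = tr J = 0`, `Literature.Barriers.NavierStokesRegularity.divergence_rotGen`);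
`⟪b, ∇ω₃⟫ = Dω₃[b] = (Dω[b])₃`; `div ∇ω₃ = Δω₃ = (Δω)₃` (`divergence_gradient`, and the Laplacian
commutes with the coordinate projection, `ContDiffAt.laplacian_CLM_comp_left`); and
`div (U₃ ω) = U₃ div ω + ⟪ω, ∇U₃⟫ = DU[ω]₃` since `div curl = 0` (`divergence_curl_eq_zero_holds`).
-/

noncomputable section

open Set Function InnerProductSpace
open Literature.Analysis.FluidPDE
open scoped RealInnerProductSpace Laplacian

namespace Summit.NavierStokesRegularity.NavierStokesRegularity.Theorems.CorkscrewProfile.Birth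

set_option linter.dupNamespace false

/-- **Tool stub V2 — the vertical-vorticity flux in divergence form (pure calculus).** For
`U ∈ C³(ℝ³; ℝ³)` with `div U = 0` and any `α ∈ ℝ`, the flux
`F = ω₃ b − ∇ω₃ − U₃ ω` (`ω = curl U`, `ω₃ = (curl U ·) 2`, `U₃ = (U ·) 2`, `b y = U y + ½y − α J y`)
satisfies `div F (y) = (Dω(y)[b y])₃ + (3/2) ω₃(y) − (Δω)(y)₃ − (DU(y)[ω y])₃`: Leibniz rule for
`div (θ u)`, `div b = 0 + 3/2 − α·0`, `div ∇ω₃ = Δω₃ = (Δω)₃`, `div (U₃ ω) = DU[ω]₃` as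
`div curl = 0` (Majda–Bertozzi, §1.1, vector identities). [folklore] -/
theorem stub_verticalVorticityDivergenceForm {α : ℝ}
    {U : EuclideanSpace ℝ (Fin 3) → EuclideanSpace ℝ (Fin 3)} (hU : ContDiff ℝ 3 U)
    (hdiv : VectorCalculus.IsDivFree U) (y : EuclideanSpace ℝ (Fin 3)) :
    VectorCalculus.divergence
        (fun z => (curl U z 2) • (U z + (1 / 2 : ℝ) • z - α • rotGen z)
          - gradient (fun w => curl U w 2) z - (U z 2) • curl U z) y =
      fderiv ℝ (curl U) y (U y + (1 / 2 : ℝ) • y - α • rotGen y) 2 + (3 / 2 : ℝ) * curl U y 2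
        - (Δ (curl U)) y 2 - fderiv ℝ U y (curl U y) 2 := by
  -- regularity of `U`, `ω = curl U`, the coordinate functions `ω₃`, `U₃`, the drift `b` and `∇ω₃`
  have hUd : Differentiable ℝ U := hU.differentiable (by norm_num)
  have hω2 : ContDiff ℝ 2 (curl U) := contDiff_curl (n := 2) (by exact_mod_cast hU)
  have hωd : Differentiable ℝ (curl U) := hω2.differentiable two_ne_zero
  have hω₃2 : ContDiff ℝ 2 (fun w => curl U w 2) :=
    (EuclideanSpace.proj (2 : Fin 3) : EuclideanSpace ℝ (Fin 3) →L[ℝ] ℝ).contDiff.comp hω2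
  have hω₃d : Differentiable ℝ (fun w => curl U w 2) := hω₃2.differentiable two_ne_zero
  have hU₃d : Differentiable ℝ (fun w => U w 2) :=
    (EuclideanSpace.proj (2 : Fin 3) : EuclideanSpace ℝ (Fin 3) →L[ℝ] ℝ).differentiable.comp hUd
  have hgradd : Differentiable ℝ (gradient (fun w => curl U w 2)) :=
    ((InnerProductSpace.toDual ℝ (EuclideanSpace ℝ (Fin 3))).symm.contDiff.comp
      (hω₃2.fderiv_right (m := 1) le_rfl)).differentiable one_ne_zero
  have hhalf : ∀ x : EuclideanSpace ℝ (Fin 3),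
      DifferentiableAt ℝ (fun z : EuclideanSpace ℝ (Fin 3) => (1 / 2 : ℝ) • z) x := fun x =>
    (hasFDerivAt_half_smul_id x).differentiableAt
  have hrotd : ∀ x : EuclideanSpace ℝ (Fin 3), DifferentiableAt ℝ rotGen x := fun x =>
    (hasFDerivAt_rotGen x).differentiableAt
  have hbd : DifferentiableAt ℝ (fun z => U z + (1 / 2 : ℝ) • z - α • rotGen z) y :=
    ((hUd y).fun_add (hhalf y)).fun_sub ((hrotd y).fun_const_smul α)
  -- coordinates commute with the derivative
  have hcoordω : ∀ v, fderiv ℝ (fun w => curl U w 2) y v = fderiv ℝ (curl U) y v 2 := fun v => by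
    have h : HasFDerivAt (fun w => curl U w 2)
        ((EuclideanSpace.proj (2 : Fin 3) : EuclideanSpace ℝ (Fin 3) →L[ℝ] ℝ).comp
          (fderiv ℝ (curl U) y)) y :=
      (EuclideanSpace.proj (2 : Fin 3) : EuclideanSpace ℝ (Fin 3) →L[ℝ] ℝ).hasFDerivAt.comp y
        (hωd y).hasFDerivAt
    rw [h.fderiv]
    rfl
  have hcoordU : ∀ v, fderiv ℝ (fun w => U w 2) y v = fderiv ℝ U y v 2 := fun v => by
    have h : HasFDerivAt (fun w => U w 2)
        ((EuclideanSpace.proj (2 : Fin 3) : EuclideanSpace ℝ (Fin 3) →L[ℝ] ℝ).comp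
          (fderiv ℝ U y)) y :=
      (EuclideanSpace.proj (2 : Fin 3) : EuclideanSpace ℝ (Fin 3) →L[ℝ] ℝ).hasFDerivAt.comp y
        (hUd y).hasFDerivAt
    rw [h.fderiv]
    rfl
  -- (1) the transport term `div (ω₃ b) = ω₃ div b + Dω₃[b]`, `div b = 3/2`
  have hdivb :
      VectorCalculus.divergence (fun z => U z + (1 / 2 : ℝ) • z - α • rotGen z) y = 3 / 2 := by
    rw [divergence_sub_apply ((hUd y).fun_add (hhalf y)) ((hrotd y).fun_const_smul α),
      divergence_add_apply (hUd y) (hhalf y), divergence_const_smul_apply (hrotd y) α, hdiv y,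
      divergence_half_smul_id, Literature.Barriers.NavierStokesRegularity.divergence_rotGen]
    ring
  have h1 : VectorCalculus.divergence
      (fun z => (curl U z 2) • (U z + (1 / 2 : ℝ) • z - α • rotGen z)) y =
        curl U y 2 * (3 / 2) + fderiv ℝ (curl U) y (U y + (1 / 2 : ℝ) • y - α • rotGen y) 2 := by
    rw [divergence_smul_apply (hω₃d y) hbd, hdivb, real_inner_comm, gradient,
      InnerProductSpace.toDual_symm_apply, hcoordω]
  -- (2) the diffusion term `div ∇ω₃ = Δω₃ = (Δω)₃`
  have h2 : VectorCalculus.divergence (gradient fun w => curl U w 2) y = (Δ (curl U)) y 2 := by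
    rw [divergence_gradient hω₃2 y,
      show (fun w => curl U w 2) =
        (EuclideanSpace.proj (2 : Fin 3) : EuclideanSpace ℝ (Fin 3) →L[ℝ] ℝ) ∘ curl U from rfl,
      ContDiffAt.laplacian_CLM_comp_left hω2.contDiffAt]
    rfl
  -- (3) the stretching term `div (U₃ ω) = U₃ div ω + DU₃[ω] = DU[ω]₃`
  have h3 :
      VectorCalculus.divergence (fun z => (U z 2) • curl U z) y = fderiv ℝ U y (curl U y) 2 := by
    rw [divergence_smul_apply (hU₃d y) (hωd y),
      divergence_curl_eq_zero_holds U (hU.of_le (by norm_num)) y, mul_zero, zero_add,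
      real_inner_comm, gradient, InnerProductSpace.toDual_symm_apply, hcoordU]
  -- assemble
  have hA : DifferentiableAt ℝ
      (fun z => (curl U z 2) • (U z + (1 / 2 : ℝ) • z - α • rotGen z)) y := (hω₃d y).fun_smul hbd
  have hC : DifferentiableAt ℝ (fun z => (U z 2) • curl U z) y := (hU₃d y).fun_smul (hωd y)
  rw [divergence_sub_apply (hA.fun_sub (hgradd y)) hC, divergence_sub_apply hA (hgradd y), h1, h2,
    h3]
  ring

end Summit.NavierStokesRegularity.NavierStokesRegularity.Theorems.CorkscrewProfile.Birth
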